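import Literature.AlgebraicGeometry.Motives.FaltingsECEndomorphismsProofs
import HarnessLib

/-!
# CM torsion core, helpers 2/8: the Cartan plane, counting, averaging

Helper file (2/8) for stub `stub_CMTorsionCoreOf` ((K†), the CM torsion core) of line
`Sketch` (isotypic–Minkowski reduction) of crux U
`Summit.ABC.ABC.Theses.IsogenyGlueCongruence.EllipticGluingPrimeBound` (stmt-ABC-13919); the stub
itself is proved in `…EllipticGluingPrimeBoundStubCMTorsionCoreOf`.

* `smul_eq_self_of_pow` (registered sub-goal) — no unipotents in the Cartan subgroup `𝔽_ℓ[φ]ˣ` of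
  the FACT-2 plane (an element commuting with `φ` whose `ℓ`-th power acts trivially is trivial);
* `CMTorsion.exists_sq_ne_and_eval_ne_zero₂` — the counting step behind "`ψ ∈ 𝔽_ℓ[φ]`" (`ℓ > 25`);
* `CMTorsion.exists_invariant_ne_zero`, `CMTorsion.smul_eq_units_smul` — invariants modulo `ℓ` lift;
  a `ker χ`-invariant vector is a `χ`-eigenvector if `H^Γ = 0`. All proved; no `def`, no fact.
-/

noncomputable section

-- `Summit.<Summit>.<Problem>` is the mandated summit-side namespace (CONVENTIONS §2); for the
-- single-conjunct summit `ABC` the two coincide, so the duplicate `ABC.ABC` is deliberate.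
set_option linter.dupNamespace false

namespace Summit.ABC.ABC.Theorems.IsotypicMinkowski

open scoped AddSubgroup Matrix

open Literature.AlgebraicGeometry.Motives

/-! ## The Cartan plane (registered sub-goal of the stub) -/


/-- **No unipotents in the Cartan subgroup.** On the FACT-2 plane `V` (`#V = ℓ²`, `φ² = D`,
`ℓ ∤ D`, `φ` not a scalar, `ℓ` odd): a group element commuting with `φ` whose `ℓ`-th power acts
trivially acts trivially. Indeed it acts as `u = p + q φ` (the commutant of the non-scalar `φ`),
`y = u - 1` satisfies `y ^ ℓ = 0` and `y² = 2 a y - n` (`a = p - 1`, `n = a² - q² D`); `n ≠ 0` would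
make `y` a unit, so `n = 0`, `(2a)^{ℓ-1} y = y^ℓ = 0`, whence `a = 0`, then `q = 0`. [folklore] -/
theorem smul_eq_self_of_pow {Γ V : Type} [Group Γ] [AddCommGroup V]
    [DistribMulAction Γ V] {ℓ : ℕ} [Fact ℓ.Prime] [Module (ZMod ℓ) V]
    (hℓ2 : ℓ ≠ 2) (hcard : Nat.card V = ℓ ^ 2)
    (φ : AddMonoid.End V) (D : ℤ)
    (hφφ : ∀ v, φ (φ v) = D • v) (hD : ¬ (ℓ : ℤ) ∣ D) (hns : ∀ c : ℤ, ∃ v, φ v ≠ c • v)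
    (σ : Γ) (hσ : ∀ v, φ (σ • v) = σ • φ v) (hpow : ∀ v : V, σ ^ ℓ • v = v) :
    ∀ v : V, σ • v = v := by
  classical
  have hprime : ℓ.Prime := Fact.out
  haveI : Finite V := Nat.finite_of_card_ne_zero (by rw [hcard]; exact pow_ne_zero _ hprime.ne_zero)
  haveI : Nontrivial V := by
    rw [← Finite.one_lt_card_iff_nontrivial, hcard]
    exact Nat.one_lt_pow two_ne_zero hprime.one_lt
  haveI : Module.Finite (ZMod ℓ) V := Module.Finite.of_finite
  have hrank : Module.finrank (ZMod ℓ) V = 2 := by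
    have h := Module.natCard_eq_pow_finrank (K := ZMod ℓ) (V := V)
    rw [hcard, Nat.card_zmod] at h
    exact (Nat.pow_right_injective hprime.two_le h).symm
  -- linear versions of `φ` and `σ`
  let φL : Module.End (ZMod ℓ) V := (φ : V →+ V).toZModLinearMap ℓ
  let u : Module.End (ZMod ℓ) V := (DistribSMul.toAddMonoidHom V σ).toZModLinearMap ℓ
  have hφL : ∀ v, φL v = φ v := fun _ ↦ rfl
  have hu : ∀ v, u v = σ • v := fun _ ↦ rfl
  have hDmod : ((D : ℤ) : ZMod ℓ) ≠ 0 := fun h ↦ hD ((ZMod.intCast_zmod_eq_zero_iff_dvd D ℓ).1 h)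
  have hφL2 : φL * φL = ((D : ℤ) : ZMod ℓ) • (1 : Module.End (ZMod ℓ) V) := by
    refine LinearMap.ext fun v ↦ ?_
    rw [Module.End.mul_apply, hφL, hφL, hφφ, LinearMap.smul_apply, Module.End.one_apply,
      Int.cast_smul_eq_zsmul]
  -- `1, φ` are linearly independent (`φ` is not a scalar)
  have hns' : ¬ ∃ c : ZMod ℓ, φL = c • 1 := by
    rintro ⟨c, hc⟩
    obtain ⟨v, hv⟩ := hns (c.val : ℤ)
    apply hv
    rw [← hφL, hc, LinearMap.smul_apply, Module.End.one_apply]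
    conv_rhs => rw [natCast_zsmul, ← Nat.cast_smul_eq_nsmul (ZMod ℓ), ZMod.natCast_zmod_val]
  have hindep : ∀ a b : ZMod ℓ, a • (1 : Module.End (ZMod ℓ) V) + b • φL = 0 → a = 0 ∧ b = 0 := by
    intro a b hab
    by_cases hb : b = 0
    · subst hb
      rw [zero_smul, add_zero] at hab
      refine ⟨?_, rfl⟩
      rcases smul_eq_zero.1 hab with h | h
      · exact h
      · exact absurd h one_ne_zero
    · exfalso
      apply hns'
      refine ⟨-(b⁻¹ * a), ?_⟩
      have h1 : b • φL = -(a • (1 : Module.End (ZMod ℓ) V)) := eq_neg_of_add_eq_zero_right hab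
      calc φL = b⁻¹ • (b • φL) := by rw [smul_smul, inv_mul_cancel₀ hb, one_smul]
        _ = -(b⁻¹ * a) • 1 := by rw [h1, smul_neg, smul_smul, neg_smul]
  -- `u = p + q φ` (the commutant of the non-scalar `φ` on a plane)
  have hcommute : u * φL = φL * u := LinearMap.ext fun v ↦ by
    rw [Module.End.mul_apply, Module.End.mul_apply, hu, hφL, hφL, hu, hσ]
  obtain ⟨p, q, hpq⟩ := exists_eq_smul_one_add_smul_of_commute hrank hns' hcommute
  -- `y = u - 1 = a + b φ` is nilpotent: `y ^ ℓ = u ^ ℓ - 1 = 0`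
  set a : ZMod ℓ := p - 1 with ha_def
  set y : Module.End (ZMod ℓ) V := u - 1 with hy_def
  have hy : y = a • 1 + q • φL := by rw [hy_def, hpq, ha_def, sub_smul, one_smul]; abel
  have hinj : Function.Injective (algebraMap (ZMod ℓ) (Module.End (ZMod ℓ) V)) := by
    intro c c' h
    rw [Algebra.algebraMap_eq_smul_one, Algebra.algebraMap_eq_smul_one] at h
    obtain ⟨v, hv⟩ := exists_ne (0 : V)
    have h' := congrArg (fun f : Module.End (ZMod ℓ) V ↦ f v) h
    simp only [LinearMap.smul_apply, Module.End.one_apply] at h'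
    exact smul_left_injective (ZMod ℓ) hv h'
  haveI : CharP (Module.End (ZMod ℓ) V) ℓ := charP_of_injective_algebraMap hinj ℓ
  have huℓ : u ^ ℓ = 1 := by
    have hun : ∀ (n : ℕ) (v : V), (u ^ n) v = σ ^ n • v := by
      intro n
      induction n with
      | zero => intro v; rw [pow_zero, pow_zero, Module.End.one_apply, one_smul]
      | succ n ih => intro v; rw [pow_succ, pow_succ, Module.End.mul_apply, hu, ih, mul_smul]
    refine LinearMap.ext fun v ↦ ?_
    rw [hun, hpow, Module.End.one_apply]
  have hyℓ : y ^ ℓ = 0 := by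
    rw [hy_def, sub_pow_expChar_of_commute _ (Commute.one_right u), huℓ, one_pow, sub_self]
  -- `y² = 2 a y - n`, `n = a² - q² D`
  set n : ZMod ℓ := a ^ 2 - q ^ 2 * ((D : ℤ) : ZMod ℓ) with hn_def
  have hy2 : y * y = (2 * a) • y - n • (1 : Module.End (ZMod ℓ) V) := by
    rw [hy, hn_def]
    simp only [add_mul, mul_add, smul_mul_assoc, mul_smul_comm, one_mul, mul_one, hφL2, smul_smul]
    module
  -- `n = 0`: otherwise `y` is a unit, contradicting nilpotence
  have hn0 : n = 0 := by
    by_contra hn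
    have hcomm' : Commute y ((2 * a) • (1 : Module.End (ZMod ℓ) V) - y) :=
      (Commute.one_right y).smul_right _ |>.sub_right (Commute.refl y)
    have hinv : y * ((2 * a) • (1 : Module.End (ZMod ℓ) V) - y) = n • 1 := by
      rw [mul_sub, mul_smul_comm, mul_one, hy2, sub_sub_cancel]
    have h1 : (n • (1 : Module.End (ZMod ℓ) V)) ^ ℓ = 0 := by
      rw [← hinv, hcomm'.mul_pow, hyℓ, zero_mul]
    rw [smul_pow, one_pow] at h1
    rcases smul_eq_zero.1 h1 with h | h
    · exact hn (pow_eq_zero_iff hprime.ne_zero |>.1 h)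
    · exact one_ne_zero h
  -- with `n = 0`: `y ^ (k + 1) = (2a) ^ k • y`, so `(2a) ^ (ℓ - 1) • y = 0`
  have hy2' : y * y = (2 * a) • y := by rw [hy2, hn0, zero_smul, sub_zero]
  have hyk : ∀ k : ℕ, y ^ (k + 1) = (2 * a) ^ k • y := by
    intro k
    induction k with
    | zero => rw [zero_add, pow_one, pow_zero, one_smul]
    | succ k ih => rw [pow_succ, ih, smul_mul_assoc, hy2', smul_smul, ← pow_succ]
  have hzero : (2 * a) ^ (ℓ - 1) • y = 0 := by
    rw [← hyk, Nat.sub_add_cancel hprime.one_le]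
    exact hyℓ
  -- hence `a = 0` and `q = 0`
  have h2 : (2 : ZMod ℓ) ≠ 0 := by
    intro h
    have h' : ((2 : ℕ) : ZMod ℓ) = 0 := by exact_mod_cast h
    rw [ZMod.natCast_eq_zero_iff] at h'
    exact hℓ2 ((Nat.prime_dvd_prime_iff_eq hprime Nat.prime_two).1 h').symm.symm
  have ha0 : a = 0 := by
    by_contra ha
    have hne : (2 * a) ^ (ℓ - 1) ≠ 0 := pow_ne_zero _ (mul_ne_zero h2 ha)
    have hy0 : y = 0 := (smul_eq_zero.1 hzero).resolve_left hne
    rw [hy] at hy0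
    exact ha (hindep a q hy0).1
  have hq0 : q = 0 := by
    have h1 : q ^ 2 * ((D : ℤ) : ZMod ℓ) = 0 := by
      have := hn0; rw [hn_def, ha0] at this; simpa using this
    rcases mul_eq_zero.1 h1 with h | h
    · exact pow_eq_zero_iff two_ne_zero |>.1 h
    · exact absurd h hDmod
  have hy0 : y = 0 := by rw [hy, ha0, hq0, zero_smul, zero_smul, add_zero]
  intro v
  have h := congrArg (fun f : Module.End (ZMod ℓ) V ↦ f v) hy0
  simp only [hy_def, LinearMap.sub_apply, Module.End.one_apply, LinearMap.zero_apply, hu] at h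
  exact sub_eq_zero.1 h

/-! ## Counting -/


namespace CMTorsion

/-- **Counting step.** For a prime `ℓ > 25` and `d ∈ 𝔽_ℓ` some `x ∈ 𝔽_ℓ` avoids the roots of
`X² - d`, of `Q_d` (degree `11`, leading coefficient `12`) and of `P_d` (monic of degree `12`),
where
`(x + √d)^{12} = P_d(x) + Q_d(x) √d` (at most `25 < ℓ` roots in all; cf. the line's
`CMIsotypicCore.exists_sq_ne_and_eval_ne_zero`). [folklore] -/
theorem exists_sq_ne_and_eval_ne_zero₂ {ℓ : ℕ} [Fact ℓ.Prime] (h25 : 25 < ℓ) (d : ZMod ℓ) :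
    ∃ x : ZMod ℓ, x ^ 2 - d ≠ 0 ∧
      12 * x ^ 11 + 220 * x ^ 9 * d + 792 * x ^ 7 * d ^ 2 + 792 * x ^ 5 * d ^ 3 +
        220 * x ^ 3 * d ^ 4 + 12 * x * d ^ 5 ≠ 0 ∧
      x ^ 12 + 66 * x ^ 10 * d + 495 * x ^ 8 * d ^ 2 + 924 * x ^ 6 * d ^ 3 +
        495 * x ^ 4 * d ^ 4 + 66 * x ^ 2 * d ^ 5 + d ^ 6 ≠ 0 := by
  classical
  have hℓ : ℓ.Prime := Fact.out
  set Q : Polynomial (ZMod ℓ) := Polynomial.C 12 * Polynomial.X ^ 11 + Polynomial.C (220 * d) *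
      Polynomial.X ^ 9 +
    Polynomial.C (792 * d ^ 2) * Polynomial.X ^ 7 + Polynomial.C (792 * d ^ 3) * Polynomial.X ^ 5 +
    Polynomial.C (220 * d ^ 4) * Polynomial.X ^ 3 + Polynomial.C (12 * d ^ 5) * Polynomial.X ^
        1 with hQ
  have hQeval : ∀ x : ZMod ℓ, Q.eval x = 12 * x ^ 11 + 220 * x ^ 9 * d + 792 * x ^ 7 * d ^ 2 +
      792 * x ^ 5 * d ^ 3 + 220 * x ^ 3 * d ^ 4 + 12 * x * d ^ 5 := fun x ↦ by
    simp only [hQ, Polynomial.eval_add, Polynomial.eval_mul, Polynomial.eval_C, Polynomial.eval_pow,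
      Polynomial.eval_X]
    ring
  set P : Polynomial (ZMod ℓ) := Polynomial.C 1 * Polynomial.X ^ 12 + Polynomial.C (66 * d) *
      Polynomial.X ^ 10 +
    Polynomial.C (495 * d ^ 2) * Polynomial.X ^ 8 + Polynomial.C (924 * d ^ 3) * Polynomial.X ^ 6 +
    Polynomial.C (495 * d ^ 4) * Polynomial.X ^ 4 + Polynomial.C (66 * d ^ 5) * Polynomial.X ^ 2 +
    Polynomial.C (d ^ 6) * Polynomial.X ^ 0 with hP
  have hPeval : ∀ x : ZMod ℓ, P.eval x = x ^ 12 + 66 * x ^ 10 * d + 495 * x ^ 8 * d ^ 2 +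
      924 * x ^ 6 * d ^ 3 + 495 * x ^ 4 * d ^ 4 + 66 * x ^ 2 * d ^ 5 + d ^ 6 := fun x ↦ by
    simp only [hP, Polynomial.eval_add, Polynomial.eval_mul, Polynomial.eval_C, Polynomial.eval_pow,
      Polynomial.eval_X]
    ring
  have h12 : (12 : ZMod ℓ) ≠ 0 := by
    intro h
    have h' : ((12 : ℕ) : ZMod ℓ) = 0 := by exact_mod_cast h
    rw [ZMod.natCast_eq_zero_iff] at h'
    exact absurd (Nat.le_of_dvd (by norm_num) h') (by omega)
  have hQne : Q ≠ 0 := by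
    intro h
    have hc : Q.coeff 11 = 12 := by
      simp only [hQ, Polynomial.coeff_add, Polynomial.coeff_C_mul_X_pow]
      norm_num
    rw [h, Polynomial.coeff_zero] at hc
    exact h12 hc.symm
  have hPne : P ≠ 0 := by
    intro h
    have hc : P.coeff 12 = 1 := by
      simp only [hP, Polynomial.coeff_add, Polynomial.coeff_C_mul_X_pow]
      norm_num
    rw [h, Polynomial.coeff_zero] at hc
    exact zero_ne_one hc
  have hQdeg : Q.natDegree ≤ 11 := by
    rw [hQ]
    refine Polynomial.natDegree_add_le_of_degree_le (Polynomial.natDegree_add_le_of_degree_le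
      (Polynomial.natDegree_add_le_of_degree_le (Polynomial.natDegree_add_le_of_degree_le
      (Polynomial.natDegree_add_le_of_degree_le ?_ ?_) ?_) ?_) ?_) ?_ <;>
      exact (Polynomial.natDegree_C_mul_X_pow_le _ _).trans (by norm_num)
  have hPdeg : P.natDegree ≤ 12 := by
    rw [hP]
    refine Polynomial.natDegree_add_le_of_degree_le (Polynomial.natDegree_add_le_of_degree_le
      (Polynomial.natDegree_add_le_of_degree_le (Polynomial.natDegree_add_le_of_degree_le
      (Polynomial.natDegree_add_le_of_degree_le (Polynomial.natDegree_add_le_of_degree_le ?_ ?_) ?_)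
      ?_) ?_) ?_) ?_ <;>
      exact (Polynomial.natDegree_C_mul_X_pow_le _ _).trans (by norm_num)
  set R : Polynomial (ZMod ℓ) := Polynomial.X ^ 2 - Polynomial.C d with hR
  have hRne : R ≠ 0 := Polynomial.X_pow_sub_C_ne_zero (by norm_num) d
  have hRdeg : R.natDegree = 2 := Polynomial.natDegree_X_pow_sub_C
  set S : Finset (ZMod ℓ) := Q.roots.toFinset ∪ R.roots.toFinset ∪ P.roots.toFinset with hS
  have hScard : S.card ≤ 25 := by
    calc S.card ≤ (Q.roots.toFinset ∪ R.roots.toFinset).card + P.roots.toFinset.card :=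
          Finset.card_union_le _ _
      _ ≤ (Q.roots.toFinset.card + R.roots.toFinset.card) + P.roots.toFinset.card := by
          gcongr; exact Finset.card_union_le _ _
      _ ≤ (Multiset.card Q.roots + Multiset.card R.roots) + Multiset.card P.roots :=
          Nat.add_le_add (Nat.add_le_add (Multiset.toFinset_card_le _) (Multiset.toFinset_card_le
              _))
            (Multiset.toFinset_card_le _)
      _ ≤ (11 + 2) + 12 := Nat.add_le_add (Nat.add_le_add ((Polynomial.card_roots' Q).trans hQdeg)
          ((Polynomial.card_roots' R).trans hRdeg.le)) ((Polynomial.card_roots' P).trans hPdeg)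
  obtain ⟨x, hx⟩ : ∃ x : ZMod ℓ, x ∉ S := by
    by_contra hcon
    push Not at hcon
    have hSu : S = Finset.univ := Finset.eq_univ_iff_forall.2 hcon
    have : Fintype.card (ZMod ℓ) ≤ 25 := by
      rw [← Finset.card_univ, ← hSu]; exact hScard
    rw [ZMod.card] at this
    omega
  rw [hS, Finset.mem_union, Finset.mem_union, not_or, not_or, Multiset.mem_toFinset,
    Multiset.mem_toFinset, Multiset.mem_toFinset, Polynomial.mem_roots hQne, Polynomial.mem_roots
        hRne,
    Polynomial.mem_roots hPne] at hx
  refine ⟨x, fun h ↦ hx.1.2 ?_, fun h ↦ hx.1.1 ?_, fun h ↦ hx.2 ?_⟩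
  · simp only [Polynomial.IsRoot.def, hR, Polynomial.eval_sub, Polynomial.eval_pow,
      Polynomial.eval_X,
      Polynomial.eval_C]
    exact h
  · rw [Polynomial.IsRoot.def, hQeval]
    exact h
  · rw [Polynomial.IsRoot.def, hPeval]
    exact h

/-! ## Averaging: invariants lift; eigenvectors for the quadratic character -/


/-- **Invariants modulo `ℓ` lift** (averaging, as in the big-image `false_of_invariant_line`): if
the image of `ρ` is finite of order prime to `ℓ` and `x ∈ 𝔽_ℓ^r` is non-zero and fixed by the
reductions `c̄(σ)`, `σ ∈ Γ₀`, then some non-zero `f ∈ H` is fixed by `ρ(Γ₀)` (lift `x`, average over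
the image of `Γ₀`; the average reduces to `|image| • x ≠ 0`). [folklore] -/
theorem exists_invariant_ne_zero {Γ H : Type} [Group Γ] [AddCommGroup H] {ℓ : ℕ} [Fact ℓ.Prime]
    (ρ : Representation ℤ Γ H) {r : ℕ} (b : Module.Basis (Fin r) ℤ H) (Γ₀ : Subgroup Γ)
    [Fintype ρ.asGroupHom.range] (hℓ : ¬ ℓ ∣ Fintype.card ρ.asGroupHom.range)
    (x : Fin r → ZMod ℓ) (hx : x ≠ 0)
    (hσ : ∀ σ ∈ Γ₀,
      ((LinearMap.toMatrix b b (ρ σ)).map (Int.cast : ℤ → ZMod ℓ)) *ᵥ x = x) :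
    ∃ f : H, (∀ σ ∈ Γ₀, ρ σ f = f) ∧ f ≠ 0 := by
  classical
  -- lift `x` to `f ∈ H`
  let xZ : Fin r → ℤ := fun i ↦ ((x i).val : ℤ)
  let red : (Fin r → ℤ) →+ (Fin r → ZMod ℓ) := (Int.castAddHom (ZMod ℓ)).compLeft (Fin r)
  have hred : ∀ y i, red y i = (y i : ZMod ℓ) := fun y i ↦ rfl
  have hredx : red xZ = x := by
    ext i
    rw [hred]
    simp [xZ]
  let f : H := b.equivFun.symm xZ
  have hf : b.equivFun f = xZ := b.equivFun.apply_symm_apply xZ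
  -- `ρ σ f ≡ f (mod ℓ)` for `σ ∈ Γ₀`
  have hmove : ∀ σ ∈ Γ₀, red (b.equivFun (ρ σ f)) = x := fun σ hσ' ↦ by
    rw [← hσ σ hσ']
    have hrepr : (⇑(b.repr f) : Fin r → ℤ) = xZ := by rw [← Module.Basis.equivFun_apply, hf]
    have hcomp : (Int.cast : ℤ → ZMod ℓ) ∘ xZ = x := by
      ext j; rw [Function.comp_apply, ← hred, hredx]
    ext i
    rw [hred, Module.Basis.equivFun_apply, ← LinearMap.toMatrix_mulVec_repr b b (ρ σ) f]
    change Int.castRingHom (ZMod ℓ) (((LinearMap.toMatrix b b (ρ σ)).mulVec ⇑(b.repr f)) i) = _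
    rw [RingHom.map_mulVec, Int.coe_castRingHom, hrepr, hcomp]
  -- the image of `Γ₀`, a finite group of order prime to `ℓ`
  let R₀ : Subgroup (H →ₗ[ℤ] H)ˣ := (ρ.asGroupHom.comp Γ₀.subtype).range
  have hR₀le : R₀ ≤ ρ.asGroupHom.range := by
    rintro u ⟨σ, rfl⟩
    exact ⟨(σ : Γ), rfl⟩
  haveI : Finite R₀ := Finite.of_injective (Subgroup.inclusion hR₀le) (Subgroup.inclusion_injective
      hR₀le)
  haveI : Fintype R₀ := Fintype.ofFinite R₀
  have hR₀card : ¬ ℓ ∣ Fintype.card R₀ := fun h ↦ hℓ (h.trans (by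
    rw [← Nat.card_eq_fintype_card, ← Nat.card_eq_fintype_card]
    exact Subgroup.card_dvd_of_le hR₀le))
  -- the `Γ₀`-average
  let z : H := ∑ u : R₀, ((u : (H →ₗ[ℤ] H)ˣ) : H →ₗ[ℤ] H) f
  refine ⟨z, fun σ hσ' ↦ ?_, fun hz0 ↦ hx ?_⟩
  · simp only [z, map_sum]
    refine Fintype.sum_bijective (fun u ↦ ⟨ρ.asGroupHom σ, ⟨σ, hσ'⟩, rfl⟩ * u)
      (Group.mulLeft_bijective _) _ _ fun u ↦ ?_
    simp only [Subgroup.coe_mul, Units.val_mul, Module.End.mul_apply,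
        Representation.asGroupHom_apply]
  · -- `z ≡ |R₀| • f (mod ℓ)`, so `z = 0` forces `|R₀| x = 0`
    have hz : red (b.equivFun z) = Fintype.card R₀ • x := by
      simp only [z, map_sum]
      rw [Finset.sum_congr rfl (fun (u : R₀) _ ↦ show red (b.equivFun (((u : (H →ₗ[ℤ] H)ˣ) :
          H →ₗ[ℤ] H) f)) = x from by
        obtain ⟨u, σ, hσu⟩ := u
        have h : ((u : (H →ₗ[ℤ] H)ˣ) : H →ₗ[ℤ] H) = ρ σ := by
          rw [← hσu]; rfl
        change red (b.equivFun (((u : (H →ₗ[ℤ] H)ˣ) : H →ₗ[ℤ] H) f)) = x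
        rw [h]
        exact hmove σ σ.2), Finset.sum_const, Finset.card_univ]
    rw [hz0, map_zero, map_zero] at hz
    have hunit : ((Fintype.card R₀ : ℕ) : ZMod ℓ) ≠ 0 := by
      rwa [Ne, ZMod.natCast_eq_zero_iff]
    have h := congrArg (fun y ↦ ((Fintype.card R₀ : ℕ) : ZMod ℓ)⁻¹ • y) hz
    simp only [smul_zero] at h
    rw [← Nat.cast_smul_eq_nsmul (ZMod ℓ), inv_smul_smul₀ hunit] at h
    exact h.symm

/-- **A `ker χ`-invariant is a `χ`-eigenvector** when `H` has no `Γ`-invariants: for `σ₀` with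
`χ(σ₀) = -1`, `f + ρ(σ₀) f` is `Γ`-invariant, hence zero. [folklore] -/
theorem smul_eq_units_smul {Γ H : Type} [Group Γ] [AddCommGroup H]
    (ρ : Representation ℤ Γ H) (χ : Γ →* ℤˣ)
    (hfix : ∀ f : H, (∀ σ, ρ σ f = f) → f = 0) (f : H) (hf : ∀ σ, χ σ = 1 → ρ σ f = f) :
    ∀ σ, ρ σ f = ((χ σ : ℤˣ) : ℤ) • f := by
  by_cases hall : ∀ σ, χ σ = 1
  · intro σ
    rw [hf σ (hall σ), hall σ, Units.val_one, one_smul]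
  push Not at hall
  obtain ⟨σ₀, hσ₀⟩ := hall
  have hχ₀ : χ σ₀ = -1 := (Int.units_eq_one_or (χ σ₀)).resolve_left hσ₀
  have hneg : ∀ τ, χ τ ≠ 1 → χ τ = -1 := fun τ h ↦ (Int.units_eq_one_or (χ τ)).resolve_left h
  set g := ρ σ₀ f with hg
  -- `f + g` is `Γ`-invariant, hence zero
  have hinv : ∀ τ, ρ τ (f + g) = f + g := by
    intro τ
    rw [map_add]
    by_cases hτ : χ τ = 1
    · have h1 : ρ τ g = g := by
        rw [hg, ← Module.End.mul_apply, ← map_mul,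
          show τ * σ₀ = σ₀ * (σ₀⁻¹ * τ * σ₀) by group, map_mul, Module.End.mul_apply,
          hf _ (by rw [map_mul, map_mul, map_inv, hτ, mul_one, inv_mul_cancel])]
      rw [hf τ hτ, h1]
    · have hτ' := hneg τ hτ
      have h1 : ρ τ f = g := by
        rw [hg, show τ = σ₀ * (σ₀⁻¹ * τ) by group, map_mul, Module.End.mul_apply,
          hf _ (by rw [map_mul, map_inv, hχ₀, hτ', inv_neg, inv_one, neg_mul_neg, one_mul])]
      have h2 : ρ τ g = f := by
        rw [hg, ← Module.End.mul_apply, ← map_mul,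
          hf _ (by rw [map_mul, hχ₀, hτ', neg_mul_neg, one_mul])]
      rw [h1, h2, add_comm]
  have hfg : g = -f := eq_neg_of_add_eq_zero_right (hfix _ hinv)
  intro τ
  by_cases hτ : χ τ = 1
  · rw [hf τ hτ, hτ, Units.val_one, one_smul]
  · have hτ' := hneg τ hτ
    have h1 : ρ τ f = g := by
      rw [hg, show τ = σ₀ * (σ₀⁻¹ * τ) by group, map_mul, Module.End.mul_apply,
        hf _ (by rw [map_mul, map_inv, hχ₀, hτ', inv_neg, inv_one, neg_mul_neg, one_mul])]
    rw [h1, hfg, hτ', Units.val_neg, Units.val_one, neg_one_zsmul]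

end CMTorsion

end Summit.ABC.ABC.Theorems.IsotypicMinkowski

end
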